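import Summits.CriticalPhenomena.PercolationContinuityZ3.Theorems.FK.PressureThermodynamicLimit
import Summits.CriticalPhenomena.PercolationContinuityZ3.Theorems.FK.PressureEdgeDensity
import Summits.CriticalPhenomena.PercolationContinuityZ3.Theorems.FK.PressureDifferentiability
import HarnessLib

/-!
# FK-continuity cell, FO-10a (pressure layer, capstone): Grimmett 2006, Thm. (4.63) (a) ⟺ (c) ⟺ (d) — the random-cluster pressure on
# `ℤ^d` is differentiable at `p` iff `h⁰(p,q) = h¹(p,q)` iff `φ⁰_{p,q} = φ¹_{p,q}`; its one-sided derivatives are `d (h^{1/0}(p,q) − p)/(p(1−p))`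

Registered R84 (cell INBOX l.6112, 2026-08-24); registry row FO-10a-g338d; label PRS-H (coordinator fk-4 g187).
Cell `fk-continuity` (bschramm), row FO-10a (domain-Markov + comparison layer over FO-06); support file for the
FK-continuity transplant (`--supports stmt-CriticalPhenomena-4575`); builds on p205010 (kernel theorem, internal audit
signed; external expert review pending). Pure proofs; no definitions, no named facts, no sorries; general `d ≥ 1`.
UNCONDITIONAL infinite-volume structure; it decides nothing about FH / TP_FK / the value of `p_c(q)`.

This file discharges the hypotheses of `PressureDifferentiability.lean` (`hΦ` wired from free by `PressureThermodynamicLimit`, `hE` by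
`LatticeEdgeCounting`, `h0`/`h1` by `PressureEdgeDensity`): for `q ≥ 1`, a lattice edge `e₀` of `ℤ^d`, and ANY function `Φ : ℝ → ℝ` which
on `(0,1)` is the per-site free pressure, `|Λ_N|⁻¹ log Z⁰_{Λ_N}(x,q) → Φ(x)` (such a `Φ` exists: `exists_rcPressure`; any two agree on `(0,1)`),

* `tendsto_log_rcPartitionFunction_box_div_of_free` — it is also the wired pressure (Thm. (4.58));
* **`hasDerivWithinAt_pressure_Ioi'`**, **`hasDerivWithinAt_pressure_Iio'`** — `Φ'(p±) = d (h^{1/0}(p,q) − p)/(p(1−p))` for `p ∈ (0,1)`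
  (Grimmett's (4.77) `dG/dπ⁺ − dG/dπ⁻ = h¹ − h⁰` in the `p`-chart);
* **`differentiableAt_pressure_iff_edgeDensity_eq'`** (Thm. (4.63) (a) ⟺ (c)), **`differentiableAt_pressure_iff_rcLimit_eq'`**
  (Thm. (4.63) (a) ⟺ (d): `Φ` differentiable at `p` ⟺ `rcLimit d false p q = rcLimit d true p q`);
* `exists_rcPressure` — existence of such a `Φ` on `[0,1]`, for both boundary conditions (Thm. (4.58)).

With the countability of `{p : φ⁰_{p,q} ≠ φ¹_{p,q}}` (FO-07b `countable_setOf_rcLimit_false_ne_rcLimit_true`, Thm. (4.60)/(4.63)) this is the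
complete content of Grimmett's §4.5 uniqueness-via-pressure theorem for `q ≥ 1` along boxes, except the convexity clause of Thm. (4.58) and
the `κ`-derivative (4.84) (not typed here). NOT a binder discharge, NOT `_r4`; no statement about `p_c(q)`.

## References

* G. Grimmett, *The Random-Cluster Model*, Springer 2006 (`book:grimmett2006-random-cluster-model`): §4.5, Thm. (4.58), Thm. (4.63) and its
  proof, (4.72)–(4.78) [PDF pp. 88–93]. [Grimmett2006]
-/

noncomputable section

open Finset Filter Topology Set

namespace Summit.CriticalPhenomena.PercolationContinuityZ3.Theorems.FK

open Literature.Probability.Percolation Literature.Probability.LatticeModels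

variable {d : ℕ} {q : ℝ} {e₀ : Sym2 (Site d)} {Φ : ℝ → ℝ} {p : ℝ}

/-- **The free pressure is the wired pressure** (Grimmett 2006, Thm. (4.58)): if `|Λ_N|⁻¹ log Z⁰_{Λ_N}(x,q) → Φ(x)` then
`|Λ_N|⁻¹ log Z^b_{Λ_N}(x,q) → Φ(x)` for both `b`. [cite: Grimmett2006, Thm. (4.58)] -/
theorem tendsto_log_rcPartitionFunction_box_div_of_free {x : ℝ} (hx : x ∈ Set.Icc (0 : ℝ) 1) (hq : 1 ≤ q)
    (hΦ : Tendsto (fun N : ℕ =>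
      Real.log (rcPartitionFunction (finsetGraph (zdGraph d) (box d N)) x q (boxBC d false N)) / #(box d N)) atTop (𝓝 (Φ x)))
    (b : Bool) :
    Tendsto (fun N : ℕ =>
      Real.log (rcPartitionFunction (finsetGraph (zdGraph d) (box d N)) x q (boxBC d b N)) / #(box d N)) atTop (𝓝 (Φ x)) := by
  cases b
  · exact hΦ
  · have h := hΦ.sub (tendsto_log_rcPartitionFunction_box_free_sub_wired_div d hx hq)
    rw [sub_zero] at h
    refine h.congr fun N => ?_
    rw [sub_div]
    ring

/-- **Existence of the pressure** (Grimmett 2006, Thm. (4.58)): there is `Φ : ℝ → ℝ` with `|Λ_N|⁻¹ log Z^b_{Λ_N}(x,q) → Φ(x)` for every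
`x ∈ [0,1]` and both boundary conditions (`q ≥ 1`). [cite: Grimmett2006, Thm. (4.58)] -/
theorem exists_rcPressure (d : ℕ) (hq : 1 ≤ q) :
    ∃ Φ : ℝ → ℝ, ∀ x ∈ Set.Icc (0 : ℝ) 1, ∀ b : Bool, Tendsto (fun N : ℕ =>
      Real.log (rcPartitionFunction (finsetGraph (zdGraph d) (box d N)) x q (boxBC d b N)) / #(box d N)) atTop (𝓝 (Φ x)) := by
  classical
  have h : ∀ x : ℝ, ∃ Φx : ℝ, x ∈ Set.Icc (0 : ℝ) 1 → ∀ b : Bool, Tendsto (fun N : ℕ =>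
      Real.log (rcPartitionFunction (finsetGraph (zdGraph d) (box d N)) x q (boxBC d b N)) / #(box d N)) atTop (𝓝 Φx) := by
    intro x
    by_cases hx : x ∈ Set.Icc (0 : ℝ) 1
    · obtain ⟨Φx, -, hΦx⟩ := exists_forall_tendsto_log_rcPartitionFunction_box_div d hx hq
      exact ⟨Φx, fun _ => hΦx⟩
    · exact ⟨0, fun h => (hx h).elim⟩
  choose Φ hΦ using h
  exact ⟨Φ, hΦ⟩

/-- **`Φ'(p+) = d (h¹(p,q) − p)/(p(1−p))`** for the per-site pressure `Φ` of the random-cluster model on `ℤ^d` (`q ≥ 1`, `p ∈ (0,1)`, `e₀` a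
lattice edge; Grimmett 2006, (4.77) in the `p`-chart). [cite: Grimmett2006, proof of Thm. (4.63), (4.76)–(4.78)] -/
theorem hasDerivWithinAt_pressure_Ioi' (hp : p ∈ Set.Ioo (0 : ℝ) 1) (hq : 1 ≤ q) (he₀ : e₀ ∈ (zdGraph d).edgeSet)
    (hΦ : ∀ x ∈ Set.Ioo (0 : ℝ) 1, Tendsto (fun N : ℕ =>
      Real.log (rcPartitionFunction (finsetGraph (zdGraph d) (box d N)) x q (boxBC d false N)) / #(box d N)) atTop (𝓝 (Φ x))) :
    HasDerivWithinAt Φ (d * (wiredEdgeDensity d p q e₀ - p) / (p * (1 - p))) (Set.Ioi p) p :=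
  hasDerivWithinAt_pressure_Ioi hp hq he₀
    (fun b x hx => tendsto_log_rcPartitionFunction_box_div_of_free ⟨hx.1.le, hx.2.le⟩ hq (hΦ x hx) b)
    tendsto_card_edgeFinset_box_div_card_box
    (fun _ hx => tendsto_rcExpect_card_div_card_box_false ⟨hx.1.le, hx.2.le⟩ hq he₀)
    (fun _ hx => tendsto_rcExpect_card_div_card_box_true ⟨hx.1.le, hx.2.le⟩ hq he₀)

/-- **`Φ'(p−) = d (h⁰(p,q) − p)/(p(1−p))`** for the per-site pressure `Φ` of the random-cluster model on `ℤ^d` (`q ≥ 1`, `p ∈ (0,1)`, `e₀` a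
lattice edge; Grimmett 2006, (4.77) in the `p`-chart). [cite: Grimmett2006, proof of Thm. (4.63), (4.76)–(4.78)] -/
theorem hasDerivWithinAt_pressure_Iio' (hp : p ∈ Set.Ioo (0 : ℝ) 1) (hq : 1 ≤ q) (he₀ : e₀ ∈ (zdGraph d).edgeSet)
    (hΦ : ∀ x ∈ Set.Ioo (0 : ℝ) 1, Tendsto (fun N : ℕ =>
      Real.log (rcPartitionFunction (finsetGraph (zdGraph d) (box d N)) x q (boxBC d false N)) / #(box d N)) atTop (𝓝 (Φ x))) :
    HasDerivWithinAt Φ (d * (freeEdgeDensity d p q e₀ - p) / (p * (1 - p))) (Set.Iio p) p :=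
  hasDerivWithinAt_pressure_Iio hp hq he₀
    (fun b x hx => tendsto_log_rcPartitionFunction_box_div_of_free ⟨hx.1.le, hx.2.le⟩ hq (hΦ x hx) b)
    tendsto_card_edgeFinset_box_div_card_box
    (fun _ hx => tendsto_rcExpect_card_div_card_box_false ⟨hx.1.le, hx.2.le⟩ hq he₀)
    (fun _ hx => tendsto_rcExpect_card_div_card_box_true ⟨hx.1.le, hx.2.le⟩ hq he₀)

/-- **Grimmett 2006, Thm. (4.63) (a) ⟺ (c)**: the pressure is differentiable at `p ∈ (0,1)` iff `h⁰(p,q) = h¹(p,q)` (`q ≥ 1`).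
[cite: Grimmett2006, Thm. (4.63) ((a) ⟺ (c))] -/
theorem differentiableAt_pressure_iff_edgeDensity_eq' (hp : p ∈ Set.Ioo (0 : ℝ) 1) (hq : 1 ≤ q) (he₀ : e₀ ∈ (zdGraph d).edgeSet)
    (hΦ : ∀ x ∈ Set.Ioo (0 : ℝ) 1, Tendsto (fun N : ℕ =>
      Real.log (rcPartitionFunction (finsetGraph (zdGraph d) (box d N)) x q (boxBC d false N)) / #(box d N)) atTop (𝓝 (Φ x))) :
    DifferentiableAt ℝ Φ p ↔ freeEdgeDensity d p q e₀ = wiredEdgeDensity d p q e₀ :=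
  differentiableAt_pressure_iff_edgeDensity_eq hp hq he₀
    (fun b x hx => tendsto_log_rcPartitionFunction_box_div_of_free ⟨hx.1.le, hx.2.le⟩ hq (hΦ x hx) b)
    tendsto_card_edgeFinset_box_div_card_box
    (fun _ hx => tendsto_rcExpect_card_div_card_box_false ⟨hx.1.le, hx.2.le⟩ hq he₀)
    (fun _ hx => tendsto_rcExpect_card_div_card_box_true ⟨hx.1.le, hx.2.le⟩ hq he₀)

/-- **Grimmett 2006, Thm. (4.63) (a) ⟺ (d)**: the pressure of the random-cluster model on `ℤ^d` (`d ≥ 1`, `q ≥ 1`) is differentiable at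
`p ∈ (0,1)` iff there is a unique random-cluster measure at `(p,q)`, `φ⁰_{p,q} = φ¹_{p,q}`. [cite: Grimmett2006, Thm. (4.63) ((a) ⟺ (d))] -/
theorem differentiableAt_pressure_iff_rcLimit_eq' (hd : 0 < d) (hp : p ∈ Set.Ioo (0 : ℝ) 1) (hq : 1 ≤ q)
    (hΦ : ∀ x ∈ Set.Ioo (0 : ℝ) 1, Tendsto (fun N : ℕ =>
      Real.log (rcPartitionFunction (finsetGraph (zdGraph d) (box d N)) x q (boxBC d false N)) / #(box d N)) atTop (𝓝 (Φ x))) :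
    DifferentiableAt ℝ Φ p ↔ rcLimit d false p q = rcLimit d true p q := by
  have he₀ : s((0 : Site d), (0 : Site d) + Pi.single ⟨0, hd⟩ 1) ∈ (zdGraph d).edgeSet := coordEdge_mem_edgeSet 0 _
  exact differentiableAt_pressure_iff_rcLimit_eq hp hq he₀
    (fun b x hx => tendsto_log_rcPartitionFunction_box_div_of_free ⟨hx.1.le, hx.2.le⟩ hq (hΦ x hx) b)
    tendsto_card_edgeFinset_box_div_card_box
    (fun _ hx => tendsto_rcExpect_card_div_card_box_false ⟨hx.1.le, hx.2.le⟩ hq he₀)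
    (fun _ hx => tendsto_rcExpect_card_div_card_box_true ⟨hx.1.le, hx.2.le⟩ hq he₀)

end Summit.CriticalPhenomena.PercolationContinuityZ3.Theorems.FK
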